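import Summits.AtomisticToContinuum.Crystallization.Theses.PalmUnimodularRigidity
import Summits.AtomisticToContinuum.Crystallization.Theorems.MinimiserShells.Negative.LoadBearing
import Summits.AtomisticToContinuum.Crystallization.Theorems.MinimiserShells.Negative.Rootedness
import Summits.AtomisticToContinuum.Crystallization.Theorems.PalmUnimodularRigidityMinimiserShellsEquilibriumInLawCluster
import Summits.AtomisticToContinuum.Crystallization.Theorems.PalmUnimodularRigidityMinimiserShellsEquilibriumInLawCellSums
import Summits.AtomisticToContinuum.Crystallization.Theorems.PalmUnimodularRigidityMinimiserShellsEquilibriumInLaw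
import Summits.AtomisticToContinuum.Crystallization.Theorems.PalmUnimodularRigidityMinimiserShellsEnergyFloor
import Summits.AtomisticToContinuum.Crystallization.Theorems.PalmUnimodularRigidityMinimiserShellsGoodShellMeasurable
import Literature.Probability.Process.PointStationaryLaw
import Literature.MathematicalPhysics.StatisticalMechanics.RootEnergy
import Literature.MathematicalPhysics.StatisticalMechanics.MuGSC

/-!
# Stub `stub_thresholdTransfer` (S8b) of line `equilibrium-in-law-surgery` (reshape r4), crux `MinimiserShells`

Crux item stmt-AtomisticToContinuum-9225, crux decl
`Summit.AtomisticToContinuum.Crystallization.Theses.PalmUnimodularRigidity.MinimiserShells`.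

**Theorem (`stub_thresholdTransfer`).**  Assume the SLACK EVENT TRANSFER (stub S8a, file `…SlackEventTransfer`:
under a minimising point-stationary `δ`-hard-core law a.s. carried by a class `K`, a measurable event whose
`R₀`-deep sites are priced at rate `c` up to a slack `s` per window site on cube windows of side `≥ L₀` —
`#C·e* + c·#G ≤ ½ΣΣ_C V + s·#C` — has probability `≤ s/c`).  Then the THRESHOLD pricing of deep badly-shelled
sites on large cube windows of the e*-DLR class (stub S7″: `∀ δ ∀ t>0 ∃ L₀ R₀ κ>0`, in every window `C = S ∩ Q`,
`Q` a half-open cube of side `L ≥ L₀`, of every `δ`-separated e*-`μ`GSC `S`, if the `R₀`-deep badly-shelled sites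
`G` have `#G ≥ t·#C` then `#C·(e* + κ) ≤ ½ΣΣ_C V`) implies `MinimiserShells`.

Proof.  S1 (`…EquilibriumInLaw.stub_equilibriumInLaw`, fed with S2 = item 9229 `…EnergyFloor.stub_energyFloor`)
puts a.e. configuration in the class `K = IsMuGSC lennardJones eStar`; S5 (`…GoodShellMeasurable`) makes the
bad-shell event a measurable `Bᶜ` modulo the hard-core class.  For `t > 0` the threshold pricing `(R₀, κ)` is an
AFFINE pricing with `c = κ`, `s = κ·t`: above threshold `#C·e* + κ·#G ≤ #C·(e* + κ) ≤ ½ΣΣ_C V` as `#G ≤ #C`;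
below threshold `κ·#G < κ·t·#C` and the free periodisation bound `#C·e* ≤ ½ΣΣ_C V`
(`EquilibriumInLaw.Cluster.card_mul_eStar_le_half_sum_sum`).  Hence `P(Bᶜ) ≤ κt/κ = t` for every `t > 0`, so
`P(Bᶜ) = 0` and the root shell is a.s. good (`ae_goodShell_of_thresholdBadPricing`, class-general).
-/

noncomputable section

open MeasureTheory ProbabilityTheory
open scoped ENNReal BigOperators Classical

namespace Summit.AtomisticToContinuum.Crystallization.Theorems.PalmUnimodularRigidityMinimiserShells.ThresholdTransfer

open Literature.Probability.Process (IsPointStationaryLaw IsRootedHardCore count_restrict_singleton_ne_zero_iff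
  map_sub_count_restrict)
open Literature.MathematicalPhysics.StatisticalMechanics (lennardJones IsMuGSC UniformlyDiscrete)
open Summit.AtomisticToContinuum.Crystallization.Theses.PalmUnimodularRigidity (MinimiserShells UnimodularEnergyLowerBound)
open Summit.AtomisticToContinuum.Crystallization.Theorems.MinimiserShells.Negative.LoadBearing
  (eStar meanRootEnergy GoodShell minimiserShells_iff)
open Summit.AtomisticToContinuum.Crystallization.Theorems.MinimiserShells.Negative.Rootedness (E3
  countable_of_separated)
open Summit.AtomisticToContinuum.Crystallization.Theorems.PalmUnimodularRigidityMinimiserShells.EquilibriumInLaw.CellSums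
  (sep_image_sub)
open Summit.AtomisticToContinuum.Crystallization.Theorems.PalmUnimodularRigidityMinimiserShells.EquilibriumInLaw.Cluster
  (card_mul_eStar_le_half_sum_sum)

/-! ## Threshold pricing is an affine pricing -/

/-- **Threshold ⇒ affine.**  If windows whose deep-event fraction is at least `t` have excess energy density at
least `κ > 0` (and `G ⊆ C`), then every window satisfies the affine (slack) pricing
`#C·e* + κ·#G ≤ ½ΣΣ_C V + (κ·t)·#C`. -/
theorem affine_of_threshold {t κ : ℝ} (ht : 0 ≤ t) (hκ : 0 < κ) {C G : Finset E3} (hGC : G ⊆ C)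
    (hthr : t * (C.card : ℝ) ≤ (G.card : ℝ) →
      (C.card : ℝ) * (eStar + κ) ≤ (∑ x ∈ C, ∑ z ∈ C, lennardJones (dist x z)) / 2) :
    (C.card : ℝ) * eStar + κ * G.card ≤ (∑ x ∈ C, ∑ z ∈ C, lennardJones (dist x z)) / 2 + κ * t * C.card := by
  have hGC' : (G.card : ℝ) ≤ (C.card : ℝ) := by exact_mod_cast Finset.card_le_card hGC
  have hfree := card_mul_eStar_le_half_sum_sum C
  have h2 : 0 ≤ κ * t * (C.card : ℝ) := by positivity
  by_cases h : t * (C.card : ℝ) ≤ (G.card : ℝ)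
  · have key := hthr h
    have h1 : κ * (G.card : ℝ) ≤ κ * (C.card : ℝ) := mul_le_mul_of_nonneg_left hGC' hκ.le
    nlinarith
  · have h' : (G.card : ℝ) < t * (C.card : ℝ) := lt_of_not_ge h
    have h1 : κ * (G.card : ℝ) ≤ κ * t * (C.card : ℝ) := by nlinarith
    linarith

/-! ## The class-general threshold transfer -/

/-- **Class-general threshold shell transfer.**  Assume the slack event transfer (stub S8a).  Under a minimising
point-stationary law on rooted `δ`-hard-core configurations that is a.s. carried by a class `K`, a THRESHOLD
pricing of deep badly-shelled sites on large cube windows of `δ`-separated `K`-configurations — for every `t > 0`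
some `L₀, R₀, κ > 0` such that cube windows of side `≥ L₀` whose `R₀`-deep badly-shelled fraction is `≥ t` have
excess energy density `≥ κ` — forces the root shell to be a.s. good. -/
theorem ae_goodShell_of_thresholdBadPricing
    (hSlack : ∀ δ : ℝ, 0 < δ → ∀ P : Measure (Measure (EuclideanSpace ℝ (Fin 3))), IsProbabilityMeasure P →
      (∀ᵐ μ ∂P, IsRootedHardCore δ μ) → IsPointStationaryLaw P → meanRootEnergy P ≤ eStar →
      ∀ K : Set (EuclideanSpace ℝ (Fin 3)) → Prop,
      (∀ᵐ μ ∂P, ∃ S : Set (EuclideanSpace ℝ (Fin 3)),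
        μ = (Measure.count : Measure (EuclideanSpace ℝ (Fin 3))).restrict S ∧ K S) →
      ∀ Ev : Set (Measure (EuclideanSpace ℝ (Fin 3))), MeasurableSet Ev →
      ∀ L₀ R₀ c s : ℝ, 0 < L₀ → 0 < R₀ → 0 < c → 0 ≤ s →
      (∀ S : Set (EuclideanSpace ℝ (Fin 3)), (∀ x ∈ S, ∀ z ∈ S, x ≠ z → δ ≤ dist x z) → K S →
        ∀ L : ℝ, L₀ ≤ L → ∀ a : Fin 3 → ℝ, ∀ C : Finset (EuclideanSpace ℝ (Fin 3)),
        (↑C : Set (EuclideanSpace ℝ (Fin 3))) = S ∩ {z : EuclideanSpace ℝ (Fin 3) | ∀ i, a i ≤ z i ∧ z i < a i + L} →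
        ∀ G : Finset (EuclideanSpace ℝ (Fin 3)), G ⊆ C →
          (∀ y ∈ G, (Measure.count : Measure (EuclideanSpace ℝ (Fin 3))).restrict ((fun z => z - y) '' S) ∈ Ev ∧
            S ∩ Metric.closedBall y R₀ ⊆ ↑C) →
          (C.card : ℝ) * eStar + c * G.card ≤ (∑ x ∈ C, ∑ z ∈ C, lennardJones (dist x z)) / 2 + s * C.card) →
      P Ev ≤ ENNReal.ofReal (s / c))
    {δ : ℝ} (hδ : 0 < δ) {P : Measure (Measure E3)} [IsProbabilityMeasure P]
    (hcore : ∀ᵐ μ ∂P, IsRootedHardCore δ μ) (hstat : IsPointStationaryLaw P) (hE : meanRootEnergy P ≤ eStar)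
    {K : Set E3 → Prop}
    (hK : ∀ᵐ μ ∂P, ∃ S : Set E3, μ = (Measure.count : Measure E3).restrict S ∧ K S)
    (hprice : ∀ t : ℝ, 0 < t → ∃ L₀ R₀ κ : ℝ, 0 < L₀ ∧ 0 < R₀ ∧ 0 < κ ∧
      ∀ S : Set E3, (∀ x ∈ S, ∀ z ∈ S, x ≠ z → δ ≤ dist x z) → K S →
      ∀ L : ℝ, L₀ ≤ L → ∀ a : Fin 3 → ℝ, ∀ C : Finset E3,
        (↑C : Set E3) = S ∩ {z : E3 | ∀ i, a i ≤ z i ∧ z i < a i + L} → ∀ G : Finset E3, G ⊆ C →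
        (∀ y ∈ G, ¬ GoodShell ((Measure.count : Measure E3).restrict ((fun z => z - y) '' S)) ∧
          S ∩ Metric.closedBall y R₀ ⊆ ↑C) →
        t * (C.card : ℝ) ≤ (G.card : ℝ) →
        (C.card : ℝ) * (eStar + κ) ≤ (∑ x ∈ C, ∑ z ∈ C, lennardJones (dist x z)) / 2) :
    ∀ᵐ μ ∂P, GoodShell μ := by
  obtain ⟨B, hBm, hB⟩ := GoodShellMeasurable.stub_goodShellMeasurable
  -- the bad-shell event `Bᶜ` has probability `≤ t` for every `t > 0`
  have hle : ∀ t : ℝ, 0 < t → P Bᶜ ≤ ENNReal.ofReal t := by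
    intro t ht
    obtain ⟨L₀, R₀, κ, hL₀, hR₀, hκ, hpr⟩ := hprice t ht
    have h := hSlack δ hδ P inferInstance hcore hstat hE K hK Bᶜ hBm.compl L₀ R₀ κ (κ * t) hL₀ hR₀ hκ
      (by positivity) ?_
    · rwa [mul_div_cancel_left₀ _ hκ.ne'] at h
    intro S hsep hKS L hL a C hC G hGC hG
    have hCS : (↑C : Set E3) ⊆ S := hC ▸ Set.inter_subset_left
    have hG' : ∀ y ∈ G, ¬ GoodShell ((Measure.count : Measure E3).restrict ((fun z => z - y) '' S)) ∧
        S ∩ Metric.closedBall y R₀ ⊆ ↑C := by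
      intro y hy
      obtain ⟨hyB, hdeep⟩ := hG y hy
      refine ⟨fun hgood => hyB ?_, hdeep⟩
      have hyS : y ∈ S := hCS (hGC hy)
      have hhc : IsRootedHardCore δ ((Measure.count : Measure E3).restrict ((fun z => z - y) '' S)) :=
        ⟨(fun z => z - y) '' S, ⟨y, hyS, sub_self y⟩, sep_image_sub hsep y, rfl⟩
      exact (hB δ hδ _ hhc).2 hgood
    have haff := affine_of_threshold ht.le hκ hGC (hpr S hsep hKS L hL a C hC G hGC hG')
    linarith
  -- hence it is null
  have hnull : P Bᶜ = 0 := by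
    by_contra hne
    have hPtop : P Bᶜ ≠ ∞ := measure_ne_top P Bᶜ
    have hp0 : 0 < (P Bᶜ).toReal := ENNReal.toReal_pos hne hPtop
    have h := hle ((P Bᶜ).toReal / 2) (by positivity)
    have : P Bᶜ < P Bᶜ :=
      calc P Bᶜ ≤ ENNReal.ofReal ((P Bᶜ).toReal / 2) := h
        _ < ENNReal.ofReal (P Bᶜ).toReal := (ENNReal.ofReal_lt_ofReal_iff hp0).2 (by linarith)
        _ = P Bᶜ := ENNReal.ofReal_toReal hPtop
    exact lt_irrefl _ this
  have hae : ∀ᵐ μ ∂P, μ ∈ B := by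
    rw [ae_iff]
    simpa only [Set.compl_def] using hnull
  filter_upwards [hcore, hae] with μ hμ hμB
  exact (hB δ hδ μ hμ).1 hμB

/-! ## The stub -/

/-- **stub_thresholdTransfer** (S8b of line `equilibrium-in-law-surgery`, reshape r4): the slack event transfer
(S8a) turns the threshold pricing of deep badly-shelled sites on the e*-DLR class (S7″) into the crux
`MinimiserShells` (S1 + S2 supply the a.s. DLR class, S5 the measurability of the shell event). -/
theorem stub_thresholdTransfer :
    (∀ δ : ℝ, 0 < δ → ∀ P : Measure (Measure (EuclideanSpace ℝ (Fin 3))), IsProbabilityMeasure P →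
      (∀ᵐ μ ∂P, IsRootedHardCore δ μ) → IsPointStationaryLaw P → meanRootEnergy P ≤ eStar →
      ∀ K : Set (EuclideanSpace ℝ (Fin 3)) → Prop,
      (∀ᵐ μ ∂P, ∃ S : Set (EuclideanSpace ℝ (Fin 3)),
        μ = (Measure.count : Measure (EuclideanSpace ℝ (Fin 3))).restrict S ∧ K S) →
      ∀ Ev : Set (Measure (EuclideanSpace ℝ (Fin 3))), MeasurableSet Ev →
      ∀ L₀ R₀ c s : ℝ, 0 < L₀ → 0 < R₀ → 0 < c → 0 ≤ s →
      (∀ S : Set (EuclideanSpace ℝ (Fin 3)), (∀ x ∈ S, ∀ z ∈ S, x ≠ z → δ ≤ dist x z) → K S →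
        ∀ L : ℝ, L₀ ≤ L → ∀ a : Fin 3 → ℝ, ∀ C : Finset (EuclideanSpace ℝ (Fin 3)),
        (↑C : Set (EuclideanSpace ℝ (Fin 3))) = S ∩ {z : EuclideanSpace ℝ (Fin 3) | ∀ i, a i ≤ z i ∧ z i < a i + L} →
        ∀ G : Finset (EuclideanSpace ℝ (Fin 3)), G ⊆ C →
          (∀ y ∈ G, (Measure.count : Measure (EuclideanSpace ℝ (Fin 3))).restrict ((fun z => z - y) '' S) ∈ Ev ∧
            S ∩ Metric.closedBall y R₀ ⊆ ↑C) →
          (C.card : ℝ) * eStar + c * G.card ≤ (∑ x ∈ C, ∑ z ∈ C, lennardJones (dist x z)) / 2 + s * C.card) →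
      P Ev ≤ ENNReal.ofReal (s / c)) →
    (∀ δ : ℝ, 0 < δ → ∀ t : ℝ, 0 < t → ∃ L₀ R₀ κ : ℝ, 0 < L₀ ∧ 0 < R₀ ∧ 0 < κ ∧
      ∀ S : Set (EuclideanSpace ℝ (Fin 3)), (∀ x ∈ S, ∀ z ∈ S, x ≠ z → δ ≤ dist x z) →
        IsMuGSC lennardJones eStar S →
        ∀ L : ℝ, L₀ ≤ L → ∀ a : Fin 3 → ℝ, ∀ C : Finset (EuclideanSpace ℝ (Fin 3)),
          (↑C : Set (EuclideanSpace ℝ (Fin 3))) =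
            S ∩ {z : EuclideanSpace ℝ (Fin 3) | ∀ i, a i ≤ z i ∧ z i < a i + L} →
        ∀ G : Finset (EuclideanSpace ℝ (Fin 3)), G ⊆ C →
          (∀ y ∈ G, ¬ GoodShell ((Measure.count : Measure (EuclideanSpace ℝ (Fin 3))).restrict
              ((fun z => z - y) '' S)) ∧ S ∩ Metric.closedBall y R₀ ⊆ ↑C) →
          t * (C.card : ℝ) ≤ (G.card : ℝ) →
          (C.card : ℝ) * (eStar + κ) ≤ (∑ x ∈ C, ∑ z ∈ C, lennardJones (dist x z)) / 2) →
    MinimiserShells := by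
  intro hSlack hprice
  rw [minimiserShells_iff]
  intro δ hδ P hP hcore hstat hE
  have hK : ∀ᵐ μ ∂P, ∃ S : Set E3, μ = (Measure.count : Measure E3).restrict S ∧ IsMuGSC lennardJones eStar S :=
    EquilibriumInLaw.stub_equilibriumInLaw EnergyFloor.stub_energyFloor δ hδ P hP hcore hstat hE
  exact ae_goodShell_of_thresholdBadPricing hSlack hδ hcore hstat hE hK (fun t ht => hprice δ hδ t ht)

end Summit.AtomisticToContinuum.Crystallization.Theorems.PalmUnimodularRigidityMinimiserShells.ThresholdTransfer

end
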